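import Literature.AlgebraicTopology.CharacteristicClasses.RealificationPontryaginClasses
import HarnessLib

/-!
# The first Pontryagin class of a Whitney sum: `p₁(V₁ ⊕ V₂) = p₁(V₁) + p₁(V₂)` modulo 2-torsion

Topic `AlgebraicTopology/CharacteristicClasses`; namespace
`Literature.AlgebraicTopology.CharacteristicClasses`.

J. Milnor, J. Stasheff, *Characteristic Classes* (1974), §15: Lemma 15.1 (p. 174: "the
complexification `ξ ⊗ ℂ` … is isomorphic to its own conjugate bundle"), hence (Lemma 14.9,
`cᵢ(ξ̄) = (-1)ⁱ cᵢ(ξ)`) *"the odd Chern classes `c₁, c₃, …` of `ξ ⊗ ℂ` are all elements of order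
2"* (p. 174), and **Theorem 15.3** (p. 175): *"If `ξ ⊕ η` is a Whitney sum then
`p(ξ ⊕ η) − p(ξ) p(η)` has order 2 … `2 (p(ξ ⊕ η) − p(ξ) p(η)) = 0`"*.  F. Hirzebruch,
*Topological Methods in Algebraic Geometry* (1966), §4.5 (p. 65–66), III): `p(ξ ⊕ η) = p(ξ)p(η)`
"modulo elements of order 2".  R. C. Kirby, *The topology of 4-manifolds* (1989), Ch. VI
(p. 43): "`p₁(τ ⊕ ν) = p₁(τ) + p₁(ν)`" for the tangent and normal bundles of an immersed
4-manifold (`H⁴(M⁴; ℤ) ≅ ℤ` has no 2-torsion).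

This file proves the degree-four case for the tree's Pontryagin classes
`pᵢ(V) = (-1)ⁱ c₂ᵢ(V ⊗ ℂ)` (`pontryaginClass`, `Complexification.lean`) of real vector bundles
in Mathlib's sense (fibrewise product `x ↦ V₁ x × V₂ x` with model `F₁ × F₂`):

* `Complexification.conjIso` — **Lemma 15.1: `V ⊗ ℂ ≅ (V ⊗ ℂ)‾`**, complex conjugation
  `u + iv ↦ u − iv`, a `ℂ`-linear isomorphism onto the conjugate bundle;
* `two_smul_chernClassZ_complexified_eq_zero` — **the odd Chern classes of `V ⊗ ℂ` have order 2**;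
* `pontryaginClass_one_prod` — **Thm. 15.3 in degree 4, exact form**:
  `p₁(V₁ ⊕ V₂) = p₁(V₁) + p₁(V₂) − c₁(V₁ ⊗ ℂ) ⌣ c₁(V₂ ⊗ ℂ)` (Whitney sum formula (C₂) for
  `(V₁ ⊕ V₂) ⊗ ℂ ≅ V₁ ⊗ ℂ ⊕ V₂ ⊗ ℂ`, `Complexification.prodIso`);
* `two_smul_pontryaginClass_one_prod_sub_eq_zero` — **`2 (p₁(V₁ ⊕ V₂) − p₁(V₁) − p₁(V₂)) = 0`**;
* `pontryaginClass_one_prod_of_torsionFree` — **`p₁(V₁ ⊕ V₂) = p₁(V₁) + p₁(V₂)` when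
  `H⁴(B; ℤ)` has no 2-torsion** (e.g. a closed connected oriented 4-manifold, Kirby VI).

Everything here is proved; no named facts (one definition, the conjugation isomorphism, data).

## References

* J. Milnor, J. Stasheff, *Characteristic Classes*, Ann. of Math. Stud. 76 (1974), §15 Lemma 15.1,
  p. 174, Thm. 15.3. [MilnorStasheffAMS76]
* F. Hirzebruch, *Topological Methods in Algebraic Geometry*, 3rd ed. (1966), §4.5 (pp. 65–66).
  [Hirzebruch1966]
* R. C. Kirby, *The topology of 4-manifolds*, LNM 1374 (1989), Ch. VI p. 43. [Kirby1989]
-/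

noncomputable section

open Function Set Bundle Topology Literature.AlgebraicTopology.SingularHomology

namespace Literature.AlgebraicTopology.CharacteristicClasses

namespace Complexification

/-! ### Complex conjugation `V ⊗ ℂ → (V ⊗ ℂ)‾` on one fibre -/

section ConjAlgebra

variable {W : Type*} [AddCommGroup W] [Module ℝ W] [TopologicalSpace W]

/-- **Complex conjugation `u + iv ↦ u − iv` as a `ℂ`-linear map `W ⊗ ℂ → (W ⊗ ℂ)‾`** into the
conjugate complex structure (Milnor–Stasheff Lemma 15.1: "`f(x + iy) = x − iy` … maps the total
space `E(ξ ⊗ ℂ)` homeomorphically onto itself, and is `ℝ`-linear … `f(i(x + iy)) = −i f(x + iy)`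
… an isomorphism of `ξ ⊗ ℂ` onto its conjugate"). Negation is written `(-1 : ℝ) • v` so that only
continuity of constant real multiples on `W` is needed. [cite: MilnorStasheffAMS76, Lemma 15.1] -/
def conjEquiv [ContinuousConstSMul ℝ W] : Complexification W ≃L[ℂ] Conj (Complexification W) where
  toFun w := Conj.toConj (mk (re w) ((-1 : ℝ) • im w))
  invFun w := mk (re (Conj.ofConj w)) ((-1 : ℝ) • im (Conj.ofConj w))
  map_add' w w' := by
    change mk (re (w + w')) ((-1 : ℝ) • im (w + w')) =
      mk (re w) ((-1 : ℝ) • im w) + mk (re w') ((-1 : ℝ) • im w')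
    apply ext <;> simp
  map_smul' z w := by
    change mk (re (z • w)) ((-1 : ℝ) • im (z • w)) =
      (starRingEnd ℂ) z • mk (re w) ((-1 : ℝ) • im w)
    apply ext <;> simp [Complex.conj_re, Complex.conj_im]
  left_inv w := by
    change mk (re (mk (re w) ((-1 : ℝ) • im w))) ((-1 : ℝ) • im (mk (re w) ((-1 : ℝ) • im w))) = w
    apply ext <;> simp
  right_inv w := by
    change mk (re (mk (re (Conj.ofConj w)) ((-1 : ℝ) • im (Conj.ofConj w))))
      ((-1 : ℝ) • im (mk (re (Conj.ofConj w)) ((-1 : ℝ) • im (Conj.ofConj w)))) = Conj.ofConj w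
    apply ext <;> simp
  continuous_toFun := by
    refine Conj.continuous_toConj.comp ((continuous_iff _).2 ⟨?_, ?_⟩)
    · show Continuous fun w : Complexification W => re w
      exact continuous_re
    · show Continuous fun w : Complexification W => (-1 : ℝ) • im w
      exact continuous_im.const_smul (-1 : ℝ)
  continuous_invFun := by
    refine (continuous_iff _).2 ⟨?_, ?_⟩
    · show Continuous fun w : Conj (Complexification W) => re (Conj.ofConj w)
      exact continuous_re.comp Conj.continuous_ofConj
    · show Continuous fun w : Conj (Complexification W) => (-1 : ℝ) • im (Conj.ofConj w)
      exact (continuous_im.comp Conj.continuous_ofConj).const_smul (-1 : ℝ)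

/-- `re` of the conjugate. [folklore] -/
@[simp] theorem re_ofConj_conjEquiv [ContinuousConstSMul ℝ W] (w : Complexification W) :
    re (Conj.ofConj (conjEquiv w)) = re w := rfl

/-- `im` of the conjugate is `-im`. [folklore] -/
@[simp] theorem im_ofConj_conjEquiv [ContinuousConstSMul ℝ W] (w : Complexification W) :
    im (Conj.ofConj (conjEquiv w)) = (-1 : ℝ) • im w := rfl

/-- `re` of the inverse conjugate. [folklore] -/
@[simp] theorem re_conjEquiv_symm [ContinuousConstSMul ℝ W] (w : Conj (Complexification W)) :
    re ((conjEquiv (W := W)).symm w) = re (Conj.ofConj w) := rfl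

/-- `im` of the inverse conjugate. [folklore] -/
@[simp] theorem im_conjEquiv_symm [ContinuousConstSMul ℝ W] (w : Conj (Complexification W)) :
    im ((conjEquiv (W := W)).symm w) = (-1 : ℝ) • im (Conj.ofConj w) := rfl

end ConjAlgebra

/-! ### Lemma 15.1: `V ⊗ ℂ ≅ (V ⊗ ℂ)‾` as complex vector bundles -/

section ConjBundle

open ComplexVectorBundle

variable {B : Type} [TopologicalSpace B]
  (F : Type) [NormedAddCommGroup F] [NormedSpace ℝ F] [FiniteDimensional ℝ F]
  (V : B → Type) [TopologicalSpace (TotalSpace F V)] [∀ x, AddCommGroup (V x)] [∀ x, Module ℝ (V x)]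
  [∀ x, TopologicalSpace (V x)] [FiberBundle F V] [VectorBundle ℝ F V]

/-- **Milnor–Stasheff Lemma 15.1: the complexification of a real vector bundle is isomorphic to
its own conjugate**, fibrewise by complex conjugation `conjEquiv`; the total maps are
`(x, u + iv) ↦ (x, u − iv)`, continuous because fibrewise real multiples of continuous maps into
`V` are continuous (`continuous_smul_fibre'`). [cite: MilnorStasheffAMS76, Lemma 15.1] -/
def conjIso : (complexified F V).Iso (complexified F V).conjugate where
  equiv x :=
    haveI := VectorBundle.continuousConstSMul_fiber ℝ F (V := V) x
    conjEquiv
  continuous_toFun := by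
    refine (Conj.continuous_total_iff (CModel F) (fun x ↦ Complexification (V x)) _).2 ?_
    refine (Complexification.continuous_total_iff F V _).2 ⟨?_, ?_⟩
    · exact (continuous_reTotal F V :)
    · exact (continuous_smul_fibre' (F := F) (V := V) (continuous_const (y := (-1 : ℝ)))
        (continuous_imTotal F V) :)
  continuous_invFun := by
    refine (Complexification.continuous_total_iff F V _).2 ⟨?_, ?_⟩
    · exact ((continuous_reTotal F V).comp
        (Conj.totalHomeomorph (CModel F) (fun x ↦ Complexification (V x))).continuous :)
    · exact (continuous_smul_fibre' (F := F) (V := V) (continuous_const (y := (-1 : ℝ)))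
        ((continuous_imTotal F V).comp
          (Conj.totalHomeomorph (CModel F) (fun x ↦ Complexification (V x))).continuous) :)

/-- **The odd Chern classes of `V ⊗ ℂ` have order two**: `2 c_i(V ⊗ ℂ) = 0` for odd `i`
(Milnor–Stasheff p. 174: by Lemma 15.1 and `cᵢ(ξ̄) = (-1)ⁱ cᵢ(ξ)`, `cᵢ(ξ ⊗ ℂ) = -cᵢ(ξ ⊗ ℂ)`).
Over a paracompact Hausdorff base. [cite: MilnorStasheffAMS76, §15 p. 174 (with Lemma 14.9)] -/
theorem two_smul_chernClassZ_complexified_eq_zero [T2Space B] [ParacompactSpace B] {i : ℕ}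
    (hi : Odd i) : (2 : ℤ) • chernClassZ (complexified F V) i = 0 := by
  have h : chernClassZ (complexified F V) i = chernClassZ (complexified F V).conjugate i := by
    rw [chernClassZ_eq, chernClassZ_eq, ComplexVectorBundle.chernClassR_congr ℤ (conjIso F V) i]
  rw [chernClassZ_conjugate, hi.neg_one_pow, neg_one_zsmul] at h
  rw [two_zsmul]
  nth_rewrite 2 [h]
  exact add_neg_cancel _

/-- In particular `2 c₁(V ⊗ ℂ) = 0`. [cite: MilnorStasheffAMS76, §15 p. 174] -/
theorem two_smul_chernClassZ_one_complexified_eq_zero [T2Space B] [ParacompactSpace B] :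
    (2 : ℤ) • chernClassZ (complexified F V) 1 = 0 :=
  two_smul_chernClassZ_complexified_eq_zero F V odd_one

end ConjBundle

end Complexification

/-! ### Theorem 15.3 in degree four -/

section WhitneySum

open Complexification ComplexVectorBundle

variable {B : Type} [TopologicalSpace B]
  (F₁ : Type) [NormedAddCommGroup F₁] [NormedSpace ℝ F₁] [FiniteDimensional ℝ F₁]
  (V₁ : B → Type) [TopologicalSpace (TotalSpace F₁ V₁)] [∀ x, AddCommGroup (V₁ x)] [∀ x, Module ℝ (V₁ x)]
  [∀ x, TopologicalSpace (V₁ x)] [FiberBundle F₁ V₁] [VectorBundle ℝ F₁ V₁]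
  (F₂ : Type) [NormedAddCommGroup F₂] [NormedSpace ℝ F₂] [FiniteDimensional ℝ F₂]
  (V₂ : B → Type) [TopologicalSpace (TotalSpace F₂ V₂)] [∀ x, AddCommGroup (V₂ x)] [∀ x, Module ℝ (V₂ x)]
  [∀ x, TopologicalSpace (V₂ x)] [FiberBundle F₂ V₂] [VectorBundle ℝ F₂ V₂]

/-- **`c₂((V₁ ⊕ V₂) ⊗ ℂ) = c₂(V₁ ⊗ ℂ) + c₁(V₁ ⊗ ℂ) ⌣ c₁(V₂ ⊗ ℂ) + c₂(V₂ ⊗ ℂ)`** — the Whitney sum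
formula (C₂) in degree four for `(V₁ ⊕ V₂) ⊗ ℂ ≅ V₁ ⊗ ℂ ⊕ V₂ ⊗ ℂ` (`Complexification.prodIso`).
[cite: Hirzebruch1966, §4.5 III) (p. 66)] -/
theorem chernClassZ_two_complexified_prod [T2Space B] [ParacompactSpace B] :
    chernClassZ (complexified (F₁ × F₂) (fun x ↦ V₁ x × V₂ x)) 2 =
      chernClassZ (complexified F₁ V₁) 2 +
        cupEven (show 1 + 1 = 2 from rfl) (chernClassZ (complexified F₁ V₁) 1)
          (chernClassZ (complexified F₂ V₂) 1) +
        chernClassZ (complexified F₂ V₂) 2 := by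
  rw [chernClassZ_eq, ComplexVectorBundle.chernClassR_congr ℤ (Complexification.prodIso F₁ V₁ F₂ V₂) 2,
    ← chernClassZ_eq]
  have h2 := theChernClassTheory.chernClass_directSum (complexified F₁ V₁) (complexified F₂ V₂) 2
  have hu : (Finset.univ : Finset (Finset.HasAntidiagonal.antidiagonal 2)) =
      {⟨(0, 2), by simp⟩, ⟨(1, 1), by simp⟩, ⟨(2, 0), by simp⟩} := by decide
  rw [hu, Finset.sum_insert (by decide), Finset.sum_pair (by decide)] at h2
  refine h2.trans ?_
  change cupEven _ (chernClassZ _ 0) (chernClassZ _ 2) +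
    (cupEven _ (chernClassZ _ 1) (chernClassZ _ 1) + cupEven _ (chernClassZ _ 2) (chernClassZ _ 0)) = _
  rw [chernClassZ_zero, chernClassZ_zero]
  have e1 : cupEven (show 0 + 2 = 2 from rfl) (singularCohomology.one ℤ B)
      (chernClassZ (complexified F₂ V₂) 2) = chernClassZ (complexified F₂ V₂) 2 :=
    one_cupProduct _
  have e2 : cupEven (show 2 + 0 = 2 from rfl) (chernClassZ (complexified F₁ V₁) 2)
      (singularCohomology.one ℤ B) = chernClassZ (complexified F₁ V₁) 2 :=
    cupProduct_one _
  rw [e1, e2]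
  abel

/-- **Milnor–Stasheff Thm. 15.3 / Hirzebruch §4.5 III) in degree four, exact form:
`p₁(V₁ ⊕ V₂) = p₁(V₁) + p₁(V₂) − c₁(V₁ ⊗ ℂ) ⌣ c₁(V₂ ⊗ ℂ)`** in `H⁴(B; ℤ)` (the correction term has
order 2 by `two_smul_chernClassZ_one_complexified_eq_zero`). [cite: MilnorStasheffAMS76, Thm. 15.3] [cite: Hirzebruch1966, §4.5 III) (p. 66)] -/
theorem pontryaginClass_one_prod [T2Space B] [ParacompactSpace B] :
    pontryaginClass (F₁ × F₂) (fun x ↦ V₁ x × V₂ x) 1 =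
      pontryaginClass F₁ V₁ 1 + pontryaginClass F₂ V₂ 1 -
        degCast ℤ (show 2 * 2 = 4 * 1 by norm_num)
          (cupEven (show 1 + 1 = 2 from rfl) (chernClassZ (complexified F₁ V₁) 1)
            (chernClassZ (complexified F₂ V₂) 1)) := by
  rw [pontryaginClass_def, pontryaginClass_def, pontryaginClass_def]
  change (-1 : ℤ) ^ 1 • degCast ℤ _ (chernClassZ (complexified (F₁ × F₂) (fun x ↦ V₁ x × V₂ x)) 2) =
    (-1 : ℤ) ^ 1 • degCast ℤ _ (chernClassZ (complexified F₁ V₁) 2) +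
      (-1 : ℤ) ^ 1 • degCast ℤ _ (chernClassZ (complexified F₂ V₂) 2) - _
  rw [chernClassZ_two_complexified_prod, pow_one, neg_one_zsmul, neg_one_zsmul, neg_one_zsmul,
    map_add, map_add]
  abel

/-- **Thm. 15.3 in degree four: `2 (p₁(V₁ ⊕ V₂) − p₁(V₁) − p₁(V₂)) = 0`.**
[cite: MilnorStasheffAMS76, Thm. 15.3] -/
theorem two_smul_pontryaginClass_one_prod_sub_eq_zero [T2Space B] [ParacompactSpace B] :
    (2 : ℤ) • (pontryaginClass (F₁ × F₂) (fun x ↦ V₁ x × V₂ x) 1 -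
      pontryaginClass F₁ V₁ 1 - pontryaginClass F₂ V₂ 1) = 0 := by
  rw [pontryaginClass_one_prod]
  have hc := two_smul_chernClassZ_one_complexified_eq_zero F₁ V₁
  rw [two_zsmul] at hc
  have h : (2 : ℤ) • cupEven (show 1 + 1 = 2 from rfl) (chernClassZ (complexified F₁ V₁) 1)
      (chernClassZ (complexified F₂ V₂) 1) = 0 := by
    rw [two_zsmul, ← LinearMap.add_apply, ← map_add, hc, map_zero, LinearMap.zero_apply]
  have : pontryaginClass F₁ V₁ 1 + pontryaginClass F₂ V₂ 1 -
      degCast ℤ (show 2 * 2 = 4 * 1 by norm_num) (cupEven (show 1 + 1 = 2 from rfl)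
        (chernClassZ (complexified F₁ V₁) 1) (chernClassZ (complexified F₂ V₂) 1)) -
      pontryaginClass F₁ V₁ 1 - pontryaginClass F₂ V₂ 1 =
      -degCast ℤ (show 2 * 2 = 4 * 1 by norm_num) (cupEven (show 1 + 1 = 2 from rfl)
        (chernClassZ (complexified F₁ V₁) 1) (chernClassZ (complexified F₂ V₂) 1)) := by abel
  rw [this, zsmul_neg, ← map_zsmul, h, map_zero, neg_zero]

/-- **`p₁(V₁ ⊕ V₂) = p₁(V₁) + p₁(V₂)` when `H⁴(B; ℤ)` has no 2-torsion** (e.g. over a closed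
connected oriented 4-manifold, `H⁴ ≅ ℤ` — Kirby VI p. 43, "`p₁(τ ⊕ ν) = p₁(τ) + p₁(ν)`").
[cite: MilnorStasheffAMS76, Thm. 15.3] [cite: Kirby1989, Ch. VI p. 43] -/
theorem pontryaginClass_one_prod_of_two_smul_injective [T2Space B] [ParacompactSpace B]
    (h2 : ∀ x : singularCohomology ℤ ℤ B (4 * 1), (2 : ℤ) • x = 0 → x = 0) :
    pontryaginClass (F₁ × F₂) (fun x ↦ V₁ x × V₂ x) 1 =
      pontryaginClass F₁ V₁ 1 + pontryaginClass F₂ V₂ 1 := by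
  have h := h2 _ (two_smul_pontryaginClass_one_prod_sub_eq_zero F₁ V₁ F₂ V₂)
  rw [sub_sub, sub_eq_zero] at h
  exact h

end WhitneySum

end Literature.AlgebraicTopology.CharacteristicClasses
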